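import Mathlib.Analysis.Complex.ExponentialBounds
import Literature.NumberTheory.LFunctions.WeilExplicitContinuous

/-!
# A witness for the oscillatory sign cone at cutoff `a = 1/2`
(route `SignCone`, item stmt-RiemannHypothesis-16302 `SignConeOscillatory`)

The unconditional rung `signConeOscillatory_upTo_log_three_half` (`SignConeEnvelopeCutoff.lean`) proves the
item for every cutoff `a ≤ (log 3)/2 ≈ 0.549`. This file shows that the rung is NOT vacuous: at cutoff
`a = 1/2` (`(log 2)/2 < 1/2 ≤ (log 3)/2`) the oscillatory node-nonnegative class is non-empty.

Witness (the refuter's two-bump design, item notes 2026-08-16): `g(u) = b(u + 9/20) - b(u - 9/20)` with `b`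
the smooth bump `Literature.NumberTheory.LFunctions.WeilContinuous.bump 24` (radii `1/50 < 1/25`, centred at `0`). Then
`tsupport g ⊆ [-1/2, 1/2]`, the autocorrelation `G = g ⋆ g̃` VANISHES at every node `log n`, `n ≥ 2`
(the integrand `g(u) conj g(u - log n)` is identically zero: the translated bumps never overlap, using
`0.69 ≤ log 2 ≤ 0.70` and `log n ≥ log 3 ≥ 0.98` for `n ≥ 3`), and `G(9/10) = -∫ b(u - 9/20)² du < 0` with
`9/10 ≥ log 2`. Main results: `exists_oscillatory_signCone_test_half`, `one_half_le_log_three_half`.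
-/

noncomputable section

-- `Summit.RiemannHypothesis.RiemannHypothesis.…` repeats a namespace component by design (D-0017 layout).
set_option linter.dupNamespace false

open scoped BigOperators ComplexConjugate
open Complex MeasureTheory Set Filter Metric

namespace Summit.RiemannHypothesis.RiemannHypothesis.Theorems.SignCone

open Literature.NumberTheory.LFunctions

-- Throughout, `b = WeilContinuous.bump 24` (radii `1/50 < 1/25`) and the witness is
-- `g = fun u => (b (u + 9/20) : ℂ) - (b (u - 9/20) : ℂ)` (written out in full: no new definitions).

/-! ## The bump -/

/-- `rOut (bump 24) = 1/25`. [folklore] -/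
theorem bump24_rOut : (WeilContinuous.bump 24).rOut = 1 / 25 := by
  rw [WeilContinuous.bump_rOut]
  norm_num

/-- `b(x) = 0` for `|x| ≥ 1/25`. [folklore] -/
theorem bump24_eq_zero {x : ℝ} (hx : 1 / 25 ≤ |x|) : (WeilContinuous.bump 24) x = 0 := by
  apply (WeilContinuous.bump 24).zero_of_le_dist
  rwa [bump24_rOut, Real.dist_eq, sub_zero]

/-- `b(0) = 1`. [folklore] -/
theorem bump24_zero : (WeilContinuous.bump 24) 0 = 1 :=
  (WeilContinuous.bump 24).one_of_mem_closedBall (mem_closedBall_self (WeilContinuous.bump 24).rIn_pos.le)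

/-! ## The witness test function -/

/-- `g(x) = 0` as soon as both bumps vanish at `x`. [folklore] -/
theorem witness_eq_zero {x : ℝ} (h₁ : 1 / 25 ≤ |x + 9 / 20|) (h₂ : 1 / 25 ≤ |x - 9 / 20|) :
    (fun u : ℝ => (((WeilContinuous.bump 24) (u + 9 / 20) : ℝ) : ℂ) - (((WeilContinuous.bump 24) (u - 9 / 20) : ℝ) : ℂ)) x = 0 := by
  simp only [bump24_eq_zero h₁, bump24_eq_zero h₂, Complex.ofReal_zero, sub_zero]

/-- `g(x) = 0` for `|x| ≤ 41/100`. [folklore] -/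
theorem witness_eq_zero_of_abs_le {x : ℝ} (hx : |x| ≤ 41 / 100) : (fun u : ℝ => (((WeilContinuous.bump 24) (u + 9 / 20) : ℝ) : ℂ) - (((WeilContinuous.bump 24) (u - 9 / 20) : ℝ) : ℂ)) x = 0 := by
  rw [abs_le] at hx
  refine witness_eq_zero ?_ ?_
  · rw [abs_of_nonneg (by linarith)]
    linarith
  · rw [abs_of_nonpos (by linarith)]
    linarith

/-- `g(x) = 0` for `|x| ≥ 49/100`. [folklore] -/
theorem witness_eq_zero_of_le_abs {x : ℝ} (hx : 49 / 100 ≤ |x|) : (fun u : ℝ => (((WeilContinuous.bump 24) (u + 9 / 20) : ℝ) : ℂ) - (((WeilContinuous.bump 24) (u - 9 / 20) : ℝ) : ℂ)) x = 0 := by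
  rcases le_abs'.1 hx with h | h
  · refine witness_eq_zero ?_ ?_
    · rw [abs_of_nonpos (by linarith)]
      linarith
    · rw [abs_of_nonpos (by linarith)]
      linarith
  · refine witness_eq_zero ?_ ?_
    · rw [abs_of_nonneg (by linarith)]
      linarith
    · rw [abs_of_nonneg (by linarith)]
      linarith

/-- `g` is a Weil test function. [folklore] -/
theorem isWeilTest_witness : IsWeilTest (fun u : ℝ => (((WeilContinuous.bump 24) (u + 9 / 20) : ℝ) : ℂ) - (((WeilContinuous.bump 24) (u - 9 / 20) : ℝ) : ℂ)) := by
  constructor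
  · have hb : ContDiff ℝ (⊤ : ℕ∞) ((WeilContinuous.bump 24) : ℝ → ℝ) := (WeilContinuous.bump 24).contDiff
    have h1 : ContDiff ℝ (⊤ : ℕ∞) fun u : ℝ => (((WeilContinuous.bump 24) (u + 9 / 20) : ℝ) : ℂ) :=
      Complex.ofRealCLM.contDiff.comp (hb.comp (contDiff_id.add contDiff_const))
    have h2 : ContDiff ℝ (⊤ : ℕ∞) fun u : ℝ => (((WeilContinuous.bump 24) (u - 9 / 20) : ℝ) : ℂ) :=
      Complex.ofRealCLM.contDiff.comp (hb.comp (contDiff_id.sub contDiff_const))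
    exact h1.sub h2
  · refine HasCompactSupport.intro (isCompact_Icc : IsCompact (Icc (-(1 / 2 : ℝ)) (1 / 2))) ?_
    intro x hx
    refine witness_eq_zero_of_le_abs ?_
    rw [mem_Icc, not_and_or, not_le, not_le] at hx
    rcases hx with h | h
    · rw [abs_of_neg (by linarith)]
      linarith
    · rw [abs_of_pos (by linarith)]
      linarith

/-- `tsupport g ⊆ [-1/2, 1/2]`. [folklore] -/
theorem tsupport_witness_subset : tsupport (fun u : ℝ => (((WeilContinuous.bump 24) (u + 9 / 20) : ℝ) : ℂ) - (((WeilContinuous.bump 24) (u - 9 / 20) : ℝ) : ℂ)) ⊆ Icc (-(1 / 2 : ℝ)) (1 / 2) := by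
  refine closure_minimal (fun x hx => ?_) isClosed_Icc
  rw [Function.mem_support] at hx
  by_contra h
  rw [mem_Icc, not_and_or, not_le, not_le] at h
  refine hx (witness_eq_zero_of_le_abs ?_)
  rcases h with h | h
  · rw [abs_of_neg (by linarith)]
    linarith
  · rw [abs_of_pos (by linarith)]
    linarith

/-! ## The autocorrelation at the nodes and at `t = 9/10` -/

/-- The autocorrelation as an integral: `(g ⋆ g̃)(t) = ∫ g(u) conj g(u - t) du`. [folklore] -/
theorem weilConv_witness_apply (t : ℝ) :
    weilConv (fun u : ℝ => (((WeilContinuous.bump 24) (u + 9 / 20) : ℝ) : ℂ) - (((WeilContinuous.bump 24) (u - 9 / 20) : ℝ) : ℂ)) (weilReflect (fun u : ℝ => (((WeilContinuous.bump 24) (u + 9 / 20) : ℝ) : ℂ) - (((WeilContinuous.bump 24) (u - 9 / 20) : ℝ) : ℂ))) t = ∫ u : ℝ, (fun u : ℝ => (((WeilContinuous.bump 24) (u + 9 / 20) : ℝ) : ℂ) - (((WeilContinuous.bump 24) (u - 9 / 20) : ℝ) : ℂ)) u * conj ((fun u : ℝ => (((WeilContinuous.bump 24) (u + 9 / 20)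 : ℝ) : ℂ) - (((WeilContinuous.bump 24) (u - 9 / 20) : ℝ) : ℂ)) (u - t)) := by
  rw [weilConv_apply]
  refine integral_congr_ae (Eventually.of_forall fun u => ?_)
  simp only [weilReflect, neg_sub]

/-- Non-overlap: for `0.69 ≤ L` with `L ≤ 0.7` or `0.98 ≤ L`, the integrand `g(u) conj g(u - L)` vanishes
identically. [folklore] -/
theorem witness_mul_translate_eq_zero {L : ℝ} (hL : 69 / 100 ≤ L) (hL' : L ≤ 7 / 10 ∨ 98 / 100 ≤ L)
    (u : ℝ) : (fun u : ℝ => (((WeilContinuous.bump 24) (u + 9 / 20) : ℝ) : ℂ) - (((WeilContinuous.bump 24) (u - 9 / 20) : ℝ) : ℂ)) u * conj ((fun u : ℝ => (((WeilContinuous.bump 24) (u + 9 / 20) : ℝ) : ℂ) - (((WeilContinuous.bump 24) (u - 9 / 20) : ℝ) : ℂ)) (u - L)) = 0 := by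
  by_cases hu1 : |u| ≤ 41 / 100
  · rw [witness_eq_zero_of_abs_le hu1, zero_mul]
  by_cases hu2 : 49 / 100 ≤ |u|
  · rw [witness_eq_zero_of_le_abs hu2, zero_mul]
  push Not at hu1 hu2
  -- `41/100 < |u| < 49/100`: the translate vanishes
  suffices h : (fun u : ℝ => (((WeilContinuous.bump 24) (u + 9 / 20) : ℝ) : ℂ) - (((WeilContinuous.bump 24) (u - 9 / 20) : ℝ) : ℂ)) (u - L) = 0 by rw [h, map_zero, mul_zero]
  have h2 : 1 / 25 ≤ |u - L - 9 / 20| := by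
    rw [abs_of_nonpos (by linarith [(abs_lt.1 hu2).2])]
    linarith [(abs_lt.1 hu2).2]
  refine witness_eq_zero ?_ h2
  rcases lt_or_ge u 0 with hu | hu
  · rw [abs_of_neg hu] at hu1
    rw [abs_of_nonpos (by linarith)]
    linarith
  · rw [abs_of_nonneg hu] at hu1 hu2
    rcases hL' with hL' | hL'
    · rw [abs_of_nonneg (by linarith)]
      linarith
    · rw [abs_of_nonpos (by linarith)]
      linarith

/-- Hence `(g ⋆ g̃)(L) = 0` for such `L`. [folklore] -/
theorem weilConv_witness_eq_zero {L : ℝ} (hL : 69 / 100 ≤ L) (hL' : L ≤ 7 / 10 ∨ 98 / 100 ≤ L) :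
    weilConv (fun u : ℝ => (((WeilContinuous.bump 24) (u + 9 / 20) : ℝ) : ℂ) - (((WeilContinuous.bump 24) (u - 9 / 20) : ℝ) : ℂ)) (weilReflect (fun u : ℝ => (((WeilContinuous.bump 24) (u + 9 / 20) : ℝ) : ℂ) - (((WeilContinuous.bump 24) (u - 9 / 20) : ℝ) : ℂ))) L = 0 := by
  rw [weilConv_witness_apply]
  simp only [witness_mul_translate_eq_zero hL hL', integral_zero]

/-- `0.69 ≤ log 2 ≤ 0.7`. [folklore] -/
theorem log_two_mem : (69 / 100 : ℝ) ≤ Real.log 2 ∧ Real.log 2 ≤ 7 / 10 :=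
  ⟨by linarith [Real.log_two_gt_d9], by linarith [Real.log_two_lt_d9]⟩

/-- `0.98 ≤ log 3` (`e^{0.98} ≤ e < 3`). [folklore] -/
theorem log_three_ge : (98 / 100 : ℝ) ≤ Real.log 3 := by
  rw [Real.le_log_iff_exp_le (by norm_num : (0 : ℝ) < 3)]
  calc Real.exp (98 / 100) ≤ Real.exp 1 := Real.exp_le_exp.2 (by norm_num)
    _ ≤ 3 := by linarith [Real.exp_one_lt_d9]

/-- `1 ≤ log 3` (`e < 3`), i.e. the cutoff `1/2` lies below `(log 3)/2`. [folklore] -/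
theorem one_half_le_log_three_half : (1 / 2 : ℝ) ≤ Real.log 3 / 2 := by
  have h : (1 : ℝ) ≤ Real.log 3 := by
    rw [Real.le_log_iff_exp_le (by norm_num : (0 : ℝ) < 3)]
    linarith [Real.exp_one_lt_d9]
  linarith

/-- **The autocorrelation vanishes at every node**: `(g ⋆ g̃)(log n) = 0` for `n ≥ 2`. [folklore] -/
theorem weilConv_witness_log_nat_eq_zero {n : ℕ} (hn : 2 ≤ n) :
    weilConv (fun u : ℝ => (((WeilContinuous.bump 24) (u + 9 / 20) : ℝ) : ℂ) - (((WeilContinuous.bump 24) (u - 9 / 20) : ℝ) : ℂ)) (weilReflect (fun u : ℝ => (((WeilContinuous.bump 24) (u + 9 / 20) : ℝ) : ℂ) - (((WeilContinuous.bump 24) (u - 9 / 20) : ℝ) : ℂ))) (Real.log n) = 0 := by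
  rcases eq_or_lt_of_le hn with rfl | hn3
  · push_cast
    exact weilConv_witness_eq_zero log_two_mem.1 (Or.inl log_two_mem.2)
  · have h3 : (3 : ℝ) ≤ n := by exact_mod_cast hn3
    have hlog : Real.log 3 ≤ Real.log n := Real.log_le_log (by norm_num) h3
    exact weilConv_witness_eq_zero (by linarith [log_three_ge]) (Or.inr (by linarith [log_three_ge]))

/-- At `t = 9/10` the integrand is `-b(u - 9/20)²` pointwise (three of the four products of bumps have
disjoint supports). [folklore] -/
theorem witness_mul_translate_nine_tenths (u : ℝ) :
    (fun u : ℝ => (((WeilContinuous.bump 24) (u + 9 / 20) : ℝ) : ℂ) - (((WeilContinuous.bump 24) (u - 9 / 20) : ℝ) : ℂ)) u * conj ((fun u : ℝ => (((WeilContinuous.bump 24) (u + 9 / 20) : ℝ) : ℂ) - (((WeilContinuous.bump 24) (u - 9 / 20) : ℝ) : ℂ)) (u - 9 / 10)) = ((-((WeilContinuous.bump 24) (u - 9 / 20)) ^ 2 : ℝ) : ℂ) := by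
  have e1 : u - 9 / 10 + 9 / 20 = u - 9 / 20 := by ring
  have e2 : u - 9 / 10 - 9 / 20 = u - 27 / 20 := by ring
  -- the three vanishing products (real identities)
  have hA : (WeilContinuous.bump 24) (u + 9 / 20) * (WeilContinuous.bump 24) (u - 9 / 20) = 0 := by
    by_cases h : |u + 9 / 20| < 1 / 25
    · rw [bump24_eq_zero (x := u - 9 / 20) (by
        rw [abs_of_neg (by linarith [(abs_lt.1 h).2])]
        linarith [(abs_lt.1 h).2]), mul_zero]
    · rw [bump24_eq_zero (not_lt.1 h), zero_mul]
  have hB : (WeilContinuous.bump 24) (u + 9 / 20) * (WeilContinuous.bump 24) (u - 27 / 20) = 0 := by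
    by_cases h : |u + 9 / 20| < 1 / 25
    · rw [bump24_eq_zero (x := u - 27 / 20) (by
        rw [abs_of_neg (by linarith [(abs_lt.1 h).2])]
        linarith [(abs_lt.1 h).2]), mul_zero]
    · rw [bump24_eq_zero (not_lt.1 h), zero_mul]
  have hC : (WeilContinuous.bump 24) (u - 9 / 20) * (WeilContinuous.bump 24) (u - 27 / 20) = 0 := by
    by_cases h : |u - 9 / 20| < 1 / 25
    · rw [bump24_eq_zero (x := u - 27 / 20) (by
        rw [abs_of_neg (by linarith [(abs_lt.1 h).2])]
        linarith [(abs_lt.1 h).2]), mul_zero]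
    · rw [bump24_eq_zero (not_lt.1 h), zero_mul]
  have hA' : (((WeilContinuous.bump 24) (u + 9 / 20) : ℝ) : ℂ) * (((WeilContinuous.bump 24) (u - 9 / 20) : ℝ) : ℂ) = 0 := by exact_mod_cast hA
  have hB' : (((WeilContinuous.bump 24) (u + 9 / 20) : ℝ) : ℂ) * (((WeilContinuous.bump 24) (u - 27 / 20) : ℝ) : ℂ) = 0 := by exact_mod_cast hB
  have hC' : (((WeilContinuous.bump 24) (u - 9 / 20) : ℝ) : ℂ) * (((WeilContinuous.bump 24) (u - 27 / 20) : ℝ) : ℂ) = 0 := by exact_mod_cast hC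
  simp only [e1, e2, map_sub, Complex.conj_ofReal]
  push_cast
  linear_combination hA' - hB' + hC'

/-- `∫ b(u - 9/20)² du > 0`. [folklore] -/
theorem integral_bump24_sq_translate_pos : 0 < ∫ u : ℝ, ((WeilContinuous.bump 24) (u - 9 / 20)) ^ 2 := by
  have hc : Continuous fun u : ℝ => ((WeilContinuous.bump 24) (u - 9 / 20)) ^ 2 :=
    ((WeilContinuous.bump 24).continuous.comp (continuous_id.sub continuous_const)).pow 2
  have hsupp : HasCompactSupport fun u : ℝ => ((WeilContinuous.bump 24) (u - 9 / 20)) ^ 2 := by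
    refine HasCompactSupport.intro (isCompact_Icc : IsCompact (Icc (0 : ℝ) 1)) fun x hx => ?_
    rw [mem_Icc, not_and_or, not_le, not_le] at hx
    have h0 : (WeilContinuous.bump 24) (x - 9 / 20) = 0 := by
      refine bump24_eq_zero ?_
      rcases hx with h | h
      · rw [abs_of_neg (by linarith)]
        linarith
      · rw [abs_of_pos (by linarith)]
        linarith
    simp [h0]
  refine integral_pos_of_integrable_nonneg_nonzero (x := 9 / 20) hc (hc.integrable_of_hasCompactSupport hsupp)
    (fun u => sq_nonneg _) ?_
  simp [bump24_zero]

/-- **The autocorrelation is negative at `t = 9/10`**: `Re (g ⋆ g̃)(9/10) = -∫ b(u - 9/20)² du < 0`.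
[folklore] -/
theorem re_weilConv_witness_nine_tenths_neg : (weilConv (fun u : ℝ => (((WeilContinuous.bump 24) (u + 9 / 20) : ℝ) : ℂ) - (((WeilContinuous.bump 24) (u - 9 / 20) : ℝ) : ℂ)) (weilReflect (fun u : ℝ => (((WeilContinuous.bump 24) (u + 9 / 20) : ℝ) : ℂ) - (((WeilContinuous.bump 24) (u - 9 / 20) : ℝ) : ℂ))) (9 / 10)).re < 0 := by
  rw [weilConv_witness_apply]
  simp only [witness_mul_translate_nine_tenths, integral_complex_ofReal, Complex.ofReal_re, integral_neg]
  linarith [integral_bump24_sq_translate_pos]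

/-! ## The witness -/

/-- **The oscillatory node-nonnegative class at cutoff `1/2` is non-empty.** There is a Weil test function `g`
supported in `[-1/2, 1/2]` whose autocorrelation `F = g ⋆ g̃` (a one-term sum, `k = 1`) satisfies
`Re F(log n) ≥ 0` for all `n ≥ 2` (indeed `F(log n) = 0`) and `Re F(t) < 0` for some `|t| ≥ log 2` (`t = 9/10`).
The hypotheses are those of the route item `SignConeOscillatory` at `a = 1/2` (`IsWeilTest g` is by definition
`ContDiff ℝ ∞ g ∧ HasCompactSupport g`, and `weilConv g (weilReflect g)` is by definition the item's
`MeasureTheory.convolution` expression), so the unconditional rung `a ≤ (log 3)/2` is not vacuous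
(`one_half_le_log_three_half`). [folklore] -/
theorem exists_oscillatory_signCone_test_half :
    ∃ g : Fin 1 → ℝ → ℂ,
      (∀ i, IsWeilTest (g i) ∧ tsupport (g i) ⊆ Icc (-(1 / 2 : ℝ)) (1 / 2)) ∧
      (∀ n : ℕ, 2 ≤ n →
        0 ≤ ((fun t => ∑ i, weilConv (g i) (weilReflect (g i)) t) (Real.log n)).re) ∧
      ∃ t : ℝ, Real.log 2 ≤ |t| ∧
        ((fun t => ∑ i, weilConv (g i) (weilReflect (g i)) t) t).re < 0 := by
  refine ⟨fun _ => (fun u : ℝ => (((WeilContinuous.bump 24) (u + 9 / 20) : ℝ) : ℂ) - (((WeilContinuous.bump 24) (u - 9 / 20) : ℝ) : ℂ)), fun _ => ⟨isWeilTest_witness, tsupport_witness_subset⟩, fun n hn => ?_,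
    ⟨9 / 10, ?_, ?_⟩⟩
  · simp only [Finset.univ_unique, Finset.sum_singleton, weilConv_witness_log_nat_eq_zero hn,
      Complex.zero_re, le_refl]
  · rw [abs_of_pos (by norm_num : (0 : ℝ) < 9 / 10)]
    linarith [Real.log_two_lt_d9]
  · simp only [Finset.univ_unique, Finset.sum_singleton]
    exact re_weilConv_witness_nine_tenths_neg

end Summit.RiemannHypothesis.RiemannHypothesis.Theorems.SignCone

end
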